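import Summits.Ventures.PercRepro.MSTheoremS

/-!
# Theorem S for a tight twin-free family in the flip form: the parts of members and differences

Dossier proofs/MINE1-theoremS.md (Theorem S, Corollary (i)), Addendum 36 (Setting), Addendum 40.
For a TIGHT family `P` without twins (every two distinct elements are separated by a member),
Theorem S in the tree's flip form (`tight_eq_sups_of_tight`, `diffs_eq_flip_of_tight`) reads, with
`R = R*(P)` the addable elements and `D = P \\ P`:
* `D` is a down-set (`isDownSet_diffs_of_twinFree`: every set is twin-closed);
* `p ∈ P ↔ p \ R ∈ D ∧ R \ p ∈ D` (`mem_iff_parts`): the members are the sets `x ∪ (R \ y)` with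
  `x ∈ L := {x ∈ D : x ∩ R = ∅}` and `y ∈ L' := {y ∈ D : y ⊆ R}` — the paper's `P = L ⊕ U` with
  `U = R − L'`;
* `z ∈ D ↔ z \ R ∈ D ∧ z ∩ R ∈ D` (`mem_diffs_iff_parts`): `D = L ⊕ L'`.
So a member `p` has the `N`-part `x_p = p \ R ∈ L` and the `M`-part `y_p = p ∩ R` with
`R \ y_p ∈ L'`, and conversely every such pair gives a member (`union_sdiff_mem`). These are the
facts the fibre reduction of Addendum 37 §1 uses on the tight trace `P = proj r F`.
-/

namespace PercRepro.MSTight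

open Finset
open scoped FinsetFamily

variable {α : Type*} [DecidableEq α] [Fintype α]

omit [DecidableEq α] [Fintype α] in
/-- In a twin-free family every set is twin-closed. -/
theorem twinClosed_of_twinFree {P : Finset (Finset α)} (htf : ∀ a b, Twin P a b → a = b)
    (Z : Finset α) : TwinClosed P Z := by
  intro a b hab ha
  rw [← htf a b hab]; exact ha

/-- **The differences of a tight twin-free family form a down-set.** -/
theorem isDownSet_diffs_of_twinFree {P : Finset (Finset α)} (hP : Tight P)
    (htf : ∀ a b, Twin P a b → a = b) : IsDownSet (P \\ P) := by
  intro W hW W' hW'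
  have hWflip : W ∈ flip (Rstar P) P := by
    rw [← diffs_eq_flip_of_tight hP]; exact hW
  rw [diffs_eq_flip_of_tight hP]
  exact mem_flip_of_subset_of_twinClosed (dichotomy_of_tight hP) hWflip hW'
    (twinClosed_of_twinFree htf W')

section Parts

variable {P : Finset (Finset α)} (hP : Tight P)
include hP

/-- **Membership in a tight family through the parts:** `p ∈ P ↔ p \ R ∈ D ∧ R \ p ∈ D`. -/
theorem mem_iff_parts {p : Finset α} :
    p ∈ P ↔ p \ Rstar P ∈ P \\ P ∧ Rstar P \ p ∈ P \\ P := by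
  have h := tight_eq_sups_of_tight hP
  rw [← diffs_eq_flip_of_tight hP] at h
  constructor
  · intro hp
    rw [h] at hp
    obtain ⟨x, hx, z, hz, hxz⟩ := mem_sups.1 hp
    rw [sup_eq_union] at hxz
    obtain ⟨hxD, hxR⟩ := mem_within.1 hx
    obtain ⟨y, hy, rfl⟩ := mem_complWithin.1 hz
    obtain ⟨hyD, hyR⟩ := mem_within.1 hy
    have hxR' : Disjoint x (Rstar P) := disjoint_of_subset_left hxR disjoint_sdiff_self_left
    subst hxz
    constructor
    · have : (x ∪ (Rstar P \ y)) \ Rstar P = x := by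
        ext a; simp only [mem_sdiff, mem_union]
        constructor
        · rintro ⟨h' | h', haR⟩
          · exact h'
          · exact absurd h'.1 haR
        · intro ha; exact ⟨Or.inl ha, disjoint_left.1 hxR' ha⟩
      rw [this]; exact hxD
    · have : Rstar P \ (x ∪ (Rstar P \ y)) = y := by
        ext a; simp only [mem_sdiff, mem_union, not_or, not_and, not_not]
        constructor
        · rintro ⟨haR, -, h'⟩; exact h' haR
        · intro ha; exact ⟨hyR ha, disjoint_right.1 hxR' (hyR ha), fun _ => ha⟩
      rw [this]; exact hyD
  · rintro ⟨h1, h2⟩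
    have hmem : p ∈ within (P \\ P) (univ \ Rstar P) ⊻ complWithin (Rstar P) (within (P \\ P) (Rstar P)) := by
      refine mem_sups.2 ⟨p \ Rstar P, mem_within.2 ⟨h1, ?_⟩, Rstar P \ (Rstar P \ p),
        mem_complWithin.2 ⟨Rstar P \ p, mem_within.2 ⟨h2, sdiff_subset⟩, rfl⟩, ?_⟩
      · exact sdiff_subset_sdiff (subset_univ _) (subset_refl _)
      · rw [sup_eq_union, sdiff_sdiff_right_self, inf_eq_inter]
        ext a; simp only [mem_union, mem_sdiff, mem_inter]; tauto
    rwa [← h] at hmem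

/-- A member `x ∪ (R \ y)` from an `N`-part `x ∈ D` disjoint from `R` and an `M`-complement
`y ∈ D` inside `R`. -/
theorem union_sdiff_mem {x y : Finset α} (hx : x ∈ P \\ P) (hxR : Disjoint x (Rstar P))
    (hy : y ∈ P \\ P) (hyR : y ⊆ Rstar P) : x ∪ (Rstar P \ y) ∈ P := by
  rw [mem_iff_parts hP]
  constructor
  · have : (x ∪ (Rstar P \ y)) \ Rstar P = x := by
      ext a; simp only [mem_sdiff, mem_union]
      constructor
      · rintro ⟨h' | h', haR⟩
        · exact h'
        · exact absurd h'.1 haR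
      · intro ha; exact ⟨Or.inl ha, disjoint_left.1 hxR ha⟩
    rw [this]; exact hx
  · have : Rstar P \ (x ∪ (Rstar P \ y)) = y := by
      ext a; simp only [mem_sdiff, mem_union, not_or, not_and, not_not]
      constructor
      · rintro ⟨haR, -, h'⟩; exact h' haR
      · intro ha; exact ⟨hyR ha, disjoint_right.1 hxR (hyR ha), fun _ => ha⟩
    rw [this]; exact hy

/-- **Membership in the differences through the parts:** `z ∈ D ↔ z \ R ∈ D ∧ z ∩ R ∈ D`. -/
theorem mem_diffs_iff_parts (hD : IsDownSet (P \\ P)) {z : Finset α} :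
    z ∈ P \\ P ↔ z \ Rstar P ∈ P \\ P ∧ z ∩ Rstar P ∈ P \\ P := by
  constructor
  · intro hz
    exact ⟨hD _ hz _ sdiff_subset, hD _ hz _ inter_subset_left⟩
  · rintro ⟨h1, h2⟩
    -- `z = (z \ R) ∪ (z ∩ R)` is the difference `(x ∪ (R \ ∅)) \ (∅ ∪ (R \ (z ∩ R)))`
    have hempty : (∅ : Finset α) ∈ P \\ P := hD _ h1 _ (empty_subset _)
    have hm1 : (z \ Rstar P) ∪ (Rstar P \ ∅) ∈ P :=
      union_sdiff_mem hP h1 disjoint_sdiff_self_left hempty (empty_subset _)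
    have hm2 : (∅ : Finset α) ∪ (Rstar P \ (z ∩ Rstar P)) ∈ P :=
      union_sdiff_mem hP hempty (disjoint_empty_left _) h2 inter_subset_right
    have : z = ((z \ Rstar P) ∪ (Rstar P \ ∅)) \ (∅ ∪ (Rstar P \ (z ∩ Rstar P))) := by
      ext a
      simp only [mem_sdiff, mem_union, sdiff_empty, empty_union, mem_inter]
      tauto
    rw [this]
    exact mem_diffs.2 ⟨_, hm1, _, hm2, rfl⟩

end Parts

end PercRepro.MSTight
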